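import Mathlib
import Literature.NumberTheory.LFunctions.Zhang2022.Section17R1PrimeBulkPointwise
import Literature.NumberTheory.LFunctions.Zhang2022.Section17U021ChiR2
import Literature.NumberTheory.LFunctions.Zhang2022.Section17U021ChiR1Prelims
import HarnessLib

/-!
# Zhang (2022) §17.u021, remainder `R₁`, piece M2L-p BULK: the inner `(m₁, p)`-series —
# finite support, exchange, the `m₁`-sum majorant (M1) and the `κ`-gain `‖κ̄₂(p)‖ ≤ 4α𝓛^{11/10}`

Topic `Literature/NumberTheory/LFunctions/Zhang2022` (Landau–Siegel audit tree; verdict-neutral).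
Y. Zhang, *Discrete mean estimates and the Landau–Siegel zero*, arXiv:2211.02515v1 (2022)
[Zhang2022LandauSiegel] — **an unrefereed manuscript under adjudication**; nothing here asserts or denies
its Theorems 1–2. §17 p. 98 (u021; no bound in print). Piece M2L-p BULK of the sub-leaf `R₁` (WP16 leaf
h17_9; owner's cut 2026-08-27T02:29:31Z; blueprint `wp16/zl-w16-p3/R1-BULK-PLAN.md`, Steps A–B):
for `q₁ ≥ 1` and any `q₂`, with the `m₁`-sum majorant (M1, zl-w11-p3's piece) as a hypothesis at the
current `D`,

  `Σ'_{m₁} Σ'_{p} [D⁴ < q₂p, p prime, p ∤ q₁, 4D⁴p ≤ T²] ‖b(q₁m₁)‖‖ν₁*(q₂p)‖‖κ̄₂(m₁p)‖/(m₁p)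
     ≤ 16·C·α𝓛^{11/10}·τ₂(q₁)·Σ_{p ∈ S} ‖ν₁*(q₂p)‖/p`,

`S` = the finite set of such `p` (`p ≤ T²`): the `p`-series is a finite sum, the `m₁`-series has finite
support (`b(n) = 0` for `n ≥ PT⁻²`), the exchange is `tsum_sum`, and `‖κ̄₂(p)‖(p/φ(p))² ≤ 2α·log p·4 ≤
16α𝓛^{11/10}` (`|b₁| ≤ 2α`, `log p ≤ log T² = 2𝓛^{11/10}`). Theorems only; axioms standard.

## References

* Y. Zhang, arXiv:2211.02515v1 (2022), §17 p. 98 (u021). [cite: Zhang2022LandauSiegel, §17 u021 p.98]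
-/

noncomputable section

open Complex Real Finset ArithmeticFunction
open Literature.NumberTheory.LFunctions.Zhang2022.Skeleton
open Literature.NumberTheory.LFunctions.Zhang2022.Typed.Section17
open Literature.NumberTheory.LFunctions.Zhang2022.MeanSquareMajorant

namespace Literature.NumberTheory.LFunctions.Zhang2022.Phi3Eval

variable (c' : ℝ) {D : ℕ} (χ : DirichletCharacter ℂ D)

/-- **The `κ`-gain at a prime below the cutoff**: for `𝓛 ≥ 3`, `|c′α𝓛| ≤ 1/14`, `p` prime with
`p ≤ T²`: `‖κ̄₂(p)‖·(p/φ(p))² ≤ 16α𝓛^{11/10}`. [cite: Zhang2022LandauSiegel, §17 u021 p.98] -/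
theorem norm_kappa2bar_prime_gain_le (hℓ : 3 ≤ ell D) (hc : |c' * alpha D * ell D| ≤ 1 / 14)
    {p : ℕ} (hp : p.Prime) (hpT : (p : ℝ) ≤ bigT D ^ 2) :
    ‖kappa2bar c' D p‖ * ((p : ℝ) / p.totient) ^ 2 ≤ 16 * alpha D * ell D ^ (11 / 10 : ℝ) := by
  have hℓ0 : 0 < ell D := by linarith
  have hα0 : 0 < alpha D := alpha_pos' hℓ0
  obtain ⟨hb, -, -⟩ := b1_size_bounds (D := D) c' hℓ hc
  rw [abs_neg] at hb
  have hp0 : (0 : ℝ) < p := by exact_mod_cast hp.pos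
  have hk : ‖kappa2bar c' D p‖ ≤ 2 * alpha D * (2 * ell D ^ (11 / 10 : ℝ)) := by
    rw [norm_kappa2bar_eq]
    refine (norm_kappa₂_prime_le _ hp).trans ?_
    have hlog : Real.log p ≤ 2 * ell D ^ (11 / 10 : ℝ) := by
      calc Real.log p ≤ Real.log (bigT D ^ 2) := Real.log_le_log hp0 hpT
        _ = 2 * ell D ^ (11 / 10 : ℝ) := by rw [Real.log_pow, bigT, Real.log_exp]; push_cast; norm_num
    exact mul_le_mul hb hlog (Real.log_nonneg (by exact_mod_cast hp.one_lt.le)) (by positivity)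
  have hφ : ((p : ℝ) / p.totient) ^ 2 ≤ 4 := by
    rw [Nat.totient_prime hp]
    have h2 : (2 : ℝ) ≤ p := by exact_mod_cast hp.two_le
    have hp1 : (0 : ℝ) < ((p - 1 : ℕ) : ℝ) := by
      have : 1 ≤ p - 1 := by have := hp.two_le; omega
      exact_mod_cast this
    have hratio : (p : ℝ) / ((p - 1 : ℕ) : ℝ) ≤ 2 := by
      rw [div_le_iff₀ hp1]
      have : ((p - 1 : ℕ) : ℝ) = (p : ℝ) - 1 := by
        rw [Nat.cast_sub hp.one_lt.le]; simp
      rw [this]; linarith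
    calc ((p : ℝ) / ((p - 1 : ℕ) : ℝ)) ^ 2 ≤ 2 ^ 2 :=
          pow_le_pow_left₀ (div_nonneg hp0.le hp1.le) hratio 2
      _ = 4 := by norm_num
  calc ‖kappa2bar c' D p‖ * ((p : ℝ) / p.totient) ^ 2 ≤ (2 * alpha D * (2 * ell D ^ (11 / 10 : ℝ))) * 4 :=
        mul_le_mul hk hφ (by positivity) (by positivity)
    _ = 16 * alpha D * ell D ^ (11 / 10 : ℝ) := by ring

/-- **The inner series (blueprint Steps A–B)**: for `𝓛 ≥ 3`, `|c′α𝓛| ≤ 1/14`, `C ≥ 0`, the M1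
majorant at this `D`, and `q₁ ≥ 1`: the `(m₁,p)`-double series of the prime bulk is at most
`16Cα𝓛^{11/10}·τ₂(q₁)·Σ_{p∈S} ‖ν₁*(q₂p)‖/p`, `S` = the primes `p ≤ ⌊T²⌋` with `D⁴ < q₂p`, `p ∤ q₁`,
`4D⁴p ≤ T²`. [cite: Zhang2022LandauSiegel, §17 u021 p.98] -/
theorem inner_tsum_le (hℓ : 3 ≤ ell D) (hc : |c' * alpha D * ell D| ≤ 1 / 14) {C : ℝ} (hC : 0 ≤ C)
    (hM1D : ∀ q₁ m₂ : ℕ, 1 ≤ q₁ → 1 ≤ m₂ →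
      (∑' m₁ : ℕ, ‖bcoef D (q₁ * m₁)‖ * ‖kappa2bar c' D (m₁ * m₂)‖ / (m₁ : ℝ)) ≤
        C * (q₁.divisors.card : ℝ) * ‖kappa2bar c' D m₂‖ * ((m₂ : ℝ) / m₂.totient) ^ 2)
    {q₁ : ℕ} (hq₁ : 1 ≤ q₁) (q₂ : ℕ) :
    (∑' m₁ : ℕ, ∑' p : ℕ,
      (if (D : ℝ) ^ 4 < q₂ * p ∧ p.Prime ∧ ¬ p ∣ q₁ ∧ 4 * (D : ℝ) ^ 4 * p ≤ bigT D ^ 2 then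
        ‖bcoef D (q₁ * m₁)‖ * ‖nuOneStar c' χ (q₂ * p)‖ * ‖kappa2bar c' D (m₁ * p)‖ / ((m₁ : ℝ) * p)
        else 0)) ≤
      16 * C * alpha D * ell D ^ (11 / 10 : ℝ) * (q₁.divisors.card : ℝ) *
        ∑ p ∈ (Finset.range (⌊bigT D ^ 2⌋₊ + 1)).filter (fun p : ℕ =>
          (D : ℝ) ^ 4 < q₂ * p ∧ p.Prime ∧ ¬ p ∣ q₁ ∧ 4 * (D : ℝ) ^ 4 * p ≤ bigT D ^ 2),
          ‖nuOneStar c' χ (q₂ * p)‖ / p := by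
  classical
  set S := (Finset.range (⌊bigT D ^ 2⌋₊ + 1)).filter (fun p : ℕ =>
    (D : ℝ) ^ 4 < q₂ * p ∧ p.Prime ∧ ¬ p ∣ q₁ ∧ 4 * (D : ℝ) ^ 4 * p ≤ bigT D ^ 2) with hS
  have hℓ0 : 0 < ell D := by linarith
  have hα0 : 0 < alpha D := alpha_pos' hℓ0
  have hD0 : (1 : ℝ) ≤ (D : ℝ) ^ 4 := by
    have hD : (1 : ℝ) ≤ D := by
      have : (0 : ℝ) < D := by
        rcases Nat.eq_zero_or_pos D with h | h
        · exfalso; rw [ell, h, Nat.cast_zero, Real.log_zero] at hℓ; linarith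
        · exact_mod_cast h
      have hD1 : 1 ≤ D := by exact_mod_cast this
      exact_mod_cast hD1
    exact one_le_pow₀ hD
  -- the condition forces `p ∈ S`
  have hcondS : ∀ p : ℕ, ((D : ℝ) ^ 4 < q₂ * p ∧ p.Prime ∧ ¬ p ∣ q₁ ∧ 4 * (D : ℝ) ^ 4 * p ≤ bigT D ^ 2) →
      p ∈ S := by
    intro p hpcond
    rw [hS, Finset.mem_filter, Finset.mem_range]
    refine ⟨?_, hpcond⟩
    have h4 : (p : ℝ) ≤ bigT D ^ 2 := by
      have := hpcond.2.2.2
      nlinarith [(Nat.cast_nonneg p : (0 : ℝ) ≤ p)]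
    have : p ≤ ⌊bigT D ^ 2⌋₊ := Nat.le_floor h4
    omega
  -- the summand
  set g : ℕ → ℕ → ℝ := fun m₁ p =>
    if (D : ℝ) ^ 4 < q₂ * p ∧ p.Prime ∧ ¬ p ∣ q₁ ∧ 4 * (D : ℝ) ^ 4 * p ≤ bigT D ^ 2 then
      ‖bcoef D (q₁ * m₁)‖ * ‖nuOneStar c' χ (q₂ * p)‖ * ‖kappa2bar c' D (m₁ * p)‖ / ((m₁ : ℝ) * p)
      else 0 with hg
  -- (1) the `p`-series is a finite sum
  have hp_fin : ∀ m₁ : ℕ, ∑' p : ℕ, g m₁ p = ∑ p ∈ S, g m₁ p := by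
    intro m₁
    refine tsum_eq_sum fun p hp => ?_
    simp only [hg]
    rw [if_neg]
    exact fun h => hp (hcondS p h)
  -- (2) the `m₁`-series has finite support: `b(q₁m₁) = 0` for `m₁ ≥ ⌈P⌉`
  have hT1 : 1 ≤ bigT D := Real.one_le_exp (by positivity)
  have hbz : ∀ m₁ : ℕ, m₁ ∉ Finset.range ⌈bigP D⌉₊ → bcoef D (q₁ * m₁) = 0 := by
    intro m₁ hm
    rw [Finset.mem_range, not_lt] at hm
    refine bcoef_eq_zero_of_le hℓ ?_
    have hP0 : 0 ≤ bigP D := (Real.exp_pos _).le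
    calc bigP D / bigT D ^ 2 ≤ bigP D := by
          rw [div_le_iff₀ (by positivity)]; nlinarith [one_le_pow₀ (M₀ := ℝ) hT1 (n := 2)]
      _ ≤ ⌈bigP D⌉₊ := Nat.le_ceil _
      _ ≤ m₁ := by exact_mod_cast hm
      _ ≤ ((q₁ * m₁ : ℕ) : ℝ) := by exact_mod_cast Nat.le_mul_of_pos_left m₁ hq₁
  have hsumm : ∀ p : ℕ, Summable fun m₁ => g m₁ p := by
    intro p
    refine summable_of_ne_finset_zero (s := Finset.range ⌈bigP D⌉₊) fun m₁ hm => ?_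
    simp only [hg, hbz m₁ hm, norm_zero, zero_mul, zero_div, ite_self]
  -- (3) exchange
  have hex : ∑' m₁ : ℕ, ∑' p : ℕ, g m₁ p = ∑ p ∈ S, ∑' m₁ : ℕ, g m₁ p := by
    rw [show (∑' m₁ : ℕ, ∑' p : ℕ, g m₁ p) = ∑' m₁ : ℕ, ∑ p ∈ S, g m₁ p from tsum_congr hp_fin]
    exact Summable.tsum_finsetSum (fun p _ => hsumm p)
  rw [hex, Finset.mul_sum]
  refine Finset.sum_le_sum fun p hpS => ?_
  have hpS' := (Finset.mem_filter.1 hpS).2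
  have hcond := hpS'
  obtain ⟨_, hpr, _, h4T⟩ := hcond
  have hp0 : (0 : ℝ) < p := by exact_mod_cast hpr.pos
  have hpT : (p : ℝ) ≤ bigT D ^ 2 := by nlinarith [(Nat.cast_nonneg p : (0 : ℝ) ≤ p)]
  -- (4) for `p ∈ S`: pull out `‖ν₁*(q₂p)‖/p` and apply M1
  have hgp : ∀ m₁ : ℕ, g m₁ p = ‖nuOneStar c' χ (q₂ * p)‖ / p *
      (‖bcoef D (q₁ * m₁)‖ * ‖kappa2bar c' D (m₁ * p)‖ / (m₁ : ℝ)) := by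
    intro m₁
    simp only [hg, if_pos hpS']
    rcases Nat.eq_zero_or_pos m₁ with rfl | hm
    · simp
    · have hm0 : (0 : ℝ) < m₁ := by exact_mod_cast hm
      field_simp
  rw [tsum_congr hgp, tsum_mul_left]
  have hM := hM1D q₁ p hq₁ hpr.one_lt.le
  have hν0 : 0 ≤ ‖nuOneStar c' χ (q₂ * p)‖ / p := by positivity
  have hgain := norm_kappa2bar_prime_gain_le c' hℓ hc hpr hpT
  calc ‖nuOneStar c' χ (q₂ * p)‖ / p *
        ∑' m₁ : ℕ, ‖bcoef D (q₁ * m₁)‖ * ‖kappa2bar c' D (m₁ * p)‖ / (m₁ : ℝ)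
      ≤ ‖nuOneStar c' χ (q₂ * p)‖ / p *
          (C * (q₁.divisors.card : ℝ) * ‖kappa2bar c' D p‖ * ((p : ℝ) / p.totient) ^ 2) :=
        mul_le_mul_of_nonneg_left hM hν0
    _ = ‖nuOneStar c' χ (q₂ * p)‖ / p * (C * (q₁.divisors.card : ℝ)) *
          (‖kappa2bar c' D p‖ * ((p : ℝ) / p.totient) ^ 2) := by ring
    _ ≤ ‖nuOneStar c' χ (q₂ * p)‖ / p * (C * (q₁.divisors.card : ℝ)) *
          (16 * alpha D * ell D ^ (11 / 10 : ℝ)) :=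
        mul_le_mul_of_nonneg_left hgain (by positivity)
    _ = 16 * C * alpha D * ell D ^ (11 / 10 : ℝ) * (q₁.divisors.card : ℝ) *
          (‖nuOneStar c' χ (q₂ * p)‖ / p) := by ring

end Literature.NumberTheory.LFunctions.Zhang2022.Phi3Eval
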